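import Summits.Ventures.QEC.Census.BB.BB784RankZm1
import Summits.Ventures.QEC.Census.BB.BB784RankZm2
import Summits.Ventures.QEC.Census.BB.BB784RankZm3
import Summits.Ventures.QEC.Census.BB.BB784RankZm4
import Summits.Ventures.QEC.Census.BB.BB784RankZs
import Summits.Ventures.QEC.Census.RankRREFAppend
import Summits.Ventures.QEC.Census.BB.BB784RankZb
import Summits.Ventures.QEC.Census.RankPivotChunks
import HarnessLib

set_option maxRecDepth 200000

/-!
# `[[784,24,≤24]]` (BB.bb784): `rank₂ H^Z = 380`, chunked masks-only RREF certificate — part c (pivot columns, indices 192…379; assembly)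

`BB.bb784` = `QC(x²⁶+y⁶+y⁸, y⁷+x⁹+x²⁰)` on `ℤ₂₈ × ℤ₁₄` [BravyiEtAl2024, §5] (arXiv:2308.07915 chunk p0011 L41–47); rows `BBRows.rowsZ la lb`
and pivots `pivZ` from `Census/BB/BB784Data.lean`, masks/reduced rows in chunks from `BB784RedZ.lean`. Parts m1–m4: every reduced row re-derived from its mask (`masksOKL`, one chunk of 95 per file); part s: every check row re-assembled from
its pivot bits (`redSelL`). Parts b/c: unit pivot columns over index ranges (`List.range'` chunks, `decide +kernel` each); part c assembles
`pivotsOK` (`Census/RankPivotChunks.pivotsOK_of_forall`) and the rank (`Census/RankRREFAppend.rank_rowMatrix_of_parts`), transported to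
`BB.bb784.HZFlat` along `rowsZ_obj`. Tier KERNEL; axioms standard; no `native_decide`. HONEST FRAMING: a rank only.
-/

namespace Summit.Ventures.QEC.Census.BB784

open Matrix Literature.InformationTheory.QuantumCodes Summit.Ventures.QEC.Census BBRows

/-- Pivot chunk 5: for indices `i ∈ [192, 240)`, pivot `pivZ[i] < 784` and column `pivZ[i]` of the reduced rows is the unit vector `e_i` (`decide +kernel`). -/
theorem pivZc5_ok : ((List.range' 192 48).all fun i => ((pivZ.getD i 0 < 784 : Bool) && (colMask (rZ1 ++ rZ2 ++ rZ3 ++ rZ4) (pivZ.getD i 0) == 2 ^ i))) = true := by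
  decide +kernel

/-- Pivot chunk 6: for indices `i ∈ [240, 288)`, pivot `pivZ[i] < 784` and column `pivZ[i]` of the reduced rows is the unit vector `e_i` (`decide +kernel`). -/
theorem pivZc6_ok : ((List.range' 240 48).all fun i => ((pivZ.getD i 0 < 784 : Bool) && (colMask (rZ1 ++ rZ2 ++ rZ3 ++ rZ4) (pivZ.getD i 0) == 2 ^ i))) = true := by
  decide +kernel

/-- Pivot chunk 7: for indices `i ∈ [288, 336)`, pivot `pivZ[i] < 784` and column `pivZ[i]` of the reduced rows is the unit vector `e_i` (`decide +kernel`). -/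
theorem pivZc7_ok : ((List.range' 288 48).all fun i => ((pivZ.getD i 0 < 784 : Bool) && (colMask (rZ1 ++ rZ2 ++ rZ3 ++ rZ4) (pivZ.getD i 0) == 2 ^ i))) = true := by
  decide +kernel

/-- Pivot chunk 8: for indices `i ∈ [336, 380)`, pivot `pivZ[i] < 784` and column `pivZ[i]` of the reduced rows is the unit vector `e_i` (`decide +kernel`). -/
theorem pivZc8_ok : ((List.range' 336 44).all fun i => ((pivZ.getD i 0 < 784 : Bool) && (colMask (rZ1 ++ rZ2 ++ rZ3 ++ rZ4) (pivZ.getD i 0) == 2 ^ i))) = true := by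
  decide +kernel

/-- All 380 reduced rows re-derived from their masks: the four chunks glued by `masksOKL_append`. -/
theorem masksZ_ok : masksOKL (rowsZ la lb) (rZ1 ++ rZ2 ++ rZ3 ++ rZ4) (mZ1 ++ mZ2 ++ mZ3 ++ mZ4) = true := by
  rw [masksOKL_append (rowsZ la lb) (rZ1 ++ rZ2 ++ rZ3) (mZ1 ++ mZ2 ++ mZ3) rZ4 mZ4 (by decide +kernel),
    masksOKL_append (rowsZ la lb) (rZ1 ++ rZ2) (mZ1 ++ mZ2) rZ3 mZ3 (by decide +kernel),
    masksOKL_append (rowsZ la lb) rZ1 mZ1 rZ2 mZ2 (by decide +kernel),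
    maskZ1_ok, maskZ2_ok, maskZ3_ok, maskZ4_ok]
  rfl

/-- `|pivZ| = 380`. -/
theorem pivZ_length : pivZ.length = 380 := by
  decide +kernel

/-- `|rZ1 ++ rZ2 ++ rZ3 ++ rZ4| = 380`. -/
theorem redZ_length : (rZ1 ++ rZ2 ++ rZ3 ++ rZ4).length = 380 := by
  decide +kernel

/-- **Unit pivot columns** (`pivotsOK`) assembled from the eight index-range chunks (`RankPivotChunks.pivotsOK_of_forall`). -/
theorem pivZ_ok : pivotsOK 784 pivZ (rZ1 ++ rZ2 ++ rZ3 ++ rZ4) = true :=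
  pivotsOK_of_forall (pivZ_length.trans redZ_length.symm) fun i hi => by
    rw [pivZ_length] at hi
    rcases Nat.lt_or_ge i 48 with h1 | h1
    · exact forall_of_all_range' pivZc1_ok i (Nat.zero_le _) (by omega)
    rcases Nat.lt_or_ge i 96 with h2 | h2
    · exact forall_of_all_range' pivZc2_ok i h1 (by omega)
    rcases Nat.lt_or_ge i 144 with h3 | h3
    · exact forall_of_all_range' pivZc3_ok i h2 (by omega)
    rcases Nat.lt_or_ge i 192 with h4 | h4
    · exact forall_of_all_range' pivZc4_ok i h3 (by omega)
    rcases Nat.lt_or_ge i 240 with h5 | h5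
    · exact forall_of_all_range' pivZc5_ok i h4 (by omega)
    rcases Nat.lt_or_ge i 288 with h6 | h6
    · exact forall_of_all_range' pivZc6_ok i h5 (by omega)
    rcases Nat.lt_or_ge i 336 with h7 | h7
    · exact forall_of_all_range' pivZc7_ok i h6 (by omega)
    · exact forall_of_all_range' pivZc8_ok i h7 (by omega)

set_option maxHeartbeats 2000000 in -- large index types met by the rewrite
set_option maxRecDepth 200000 in
/-- **`rank₂ H^Z (BB.bb784) = 380`** (CERTIFIED, kernel tier): the four conjuncts of the masks-only RREF certificate, proved chunk-wise,
assembled by `rank_rowMatrix_of_parts` and transported along `rowsZ_obj`. -/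
theorem rank_HZFlat : BB.bb784.HZFlat.rank = 380 := by
  rw [← rowsZ_obj]
  exact rank_rowMatrix_of_parts (masks := mZ1 ++ mZ2 ++ mZ3 ++ mZ4) (by rw [pivZ_length]; decide) pivZ_ok masksZ_ok selZ_ok

end Summit.Ventures.QEC.Census.BB784
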